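import Summits.QuantumFields.YangMills.Theorems.UnitScaleTiltFluctuationComparisonRegPrLiftFacePlaq

/-!
# Route `UnitScaleTilt` — crux K1bR-pr `FluctuationComparisonRegPr` (stmt-QuantumFields-19201), stub `stub_oneStepSmallLift`
# (W7 line), piece (L2), layer F7: ASSEMBLY — a face-supported, S-neutral linear one-step lift with a row bound modulo coarse 2-boundaries
# of constant `λ` gives `ApproxSmallLift F (λ + C′δ₀) (452K₁²) δ₀`, hence the registered stub's per-`L` clause whenever `λ√L < 1`
# (support file `--supports stmt-QuantumFields-19201`)

Fleet seat `ym-ust-19201-p1` gen 2 (CARD-19201-oneStepSmallLift-L1L2 §0/§2 (L2-iv)).  Inputs: layers F4 (`mdist_avgFun_kernelLift_le`, accuracy)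
and F5c (`dist1_plaqHol_kernelLift_le`, plaquettes) for the kernel lift `U⋆_V = exp(ζ_V)·faceSec V`.

* §1 the second-order budget: `bianchiB = bq·δ²`, `unifB = uq·δ²`, and `plaquette bound ≤ λδ + Cq·δ₀·δ` for `0 < δ ≤ δ₀` (`Cq` explicit in
  `λ, β, K₁, R, d`).
* §2 **`approxLiftStep_of_kernel`**: `ApproxLiftStep P j (λ + (Cq+1)δ₀) (452K₁²δ²) δ` for `0 < δ ≤ δ₀`, `δ₀ ≤ 1/3`, `16K₁δ₀ ≤ 1/20`;
  **`approxSmallLift_of_kernel`**: for a family `F` and a table over `Fin 3 → Fin F.L` satisfying the four hypotheses at every run,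
  `ApproxSmallLift F (λ + (Cq+1)δ₀) (452K₁²) δ₀`.
* §3 **`exists_approxSmallLift_of_kernel`**: if `λ√L < 1`, the per-`L` clause
  `∃ κ₀ C δ₀, 0 ≤ κ₀ ∧ κ₀√L < 1 ∧ 0 ≤ C ∧ 0 < δ₀ ∧ ∀ F, F.L = L → ApproxSmallLift F κ₀ C δ₀` consumed by p2 g8's
  `oneStepSmallLift_stub_of_approx` (which needs it for EVERY `L`; `L = 3, 5, 7` have certified tables, the rest is the (L1) seats' closed form).

Elementary; nothing of Bałaban's is asserted.
-/

noncomputable section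

open scoped BigOperators Matrix.Norms.L2Operator
open NormedSpace

namespace Summit.QuantumFields.YangMills.Theorems.ApproxLift

open Literature.MathematicalPhysics.QuantumFieldTheory.Balaban1983to89
open T4Continuum BlockAveraging AveragingRT B10Eq47AxialChi BlockAveragingSection BlockAveragingSectionPlaq ExpMeanLog MatrixLog
open Literature.MathematicalPhysics.QuantumFieldTheory.Balaban1983to89.T3ContinuumYM3Torus

variable {P : Params} {j : ℕ}

/-! ## §1 The second-order budget -/

/-- The Bianchi constant as a multiple of `δ²`: `bq = 72 + 3ℓ²`, `ℓ = d(N+1) + dN + 1`. -/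
def bq (P : Params) (N : ℕ) : ℝ := 72 + 3 * (((P.d * (N + 1) + (P.d * N + 1) : ℕ) : ℝ)) ^ 2

/-- `bianchiB P N δ = bq P N · δ²`. -/
theorem bianchiB_eq (P : Params) (N : ℕ) (δ : ℝ) : bianchiB P N δ = bq P N * δ ^ 2 := by
  unfold bianchiB bq; ring

/-- The unification constant as a multiple of `δ²`: `uq = ℓ′²`, `ℓ′ = 4 + dR + d(R+1)`. -/
def uq (P : Params) (R : ℕ) : ℝ := (((4 + P.d * R + P.d * (R + 1) : ℕ) : ℝ)) ^ 2

/-- `unifB P R δ = uq P R · δ²`. -/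
theorem unifB_eq (P : Params) (R : ℕ) (δ : ℝ) : unifB P R δ = uq P R * δ ^ 2 := by
  unfold unifB uq; ring

/-- **THE SECOND-ORDER CONSTANT** `Cq` of the plaquette clause: `2λ + β·bq + 3K₁·uq + 2 + 544K₁² + 16K₁` (with `ρ(t) ≤ 11t²`, `t = 4K₁δ ≤ 1`). -/
def Cq (P : Params) (R : ℕ) (lam β K₁ : ℝ) : ℝ :=
  2 * lam + β * bq P (R + 1) + 3 * K₁ * uq P R + 2 + 544 * K₁ ^ 2 + 16 * K₁

/-- `0 ≤ Cq` for nonnegative constants. -/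
theorem Cq_nonneg (P : Params) (R : ℕ) {lam β K₁ : ℝ} (hlam : 0 ≤ lam) (hβ : 0 ≤ β) (hK : 0 ≤ K₁) : 0 ≤ Cq P R lam β K₁ := by
  unfold Cq bq uq; positivity

/-- **THE BUDGET**: the bound of `dist1_plaqHol_kernelLift_le` is `≤ λδ + Cq·δ₀·δ` for `0 < δ ≤ δ₀ ≤ 1`, `16K₁δ₀ ≤ 1/20`. -/
theorem plaqBound_le_budget (P : Params) (R : ℕ) {lam β K₁ δ δ₀ : ℝ} (hlam : 0 ≤ lam) (hβ : 0 ≤ β) (hK : 0 ≤ K₁) (hδ : 0 < δ)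
    (hδδ₀ : δ ≤ δ₀) (hδ₀ : δ₀ ≤ 1) (hKδ₀ : 16 * (K₁ * δ₀) ≤ 1 / 20) :
    lam * (δ + 2 * δ ^ 2) + β * bianchiB P (R + 1) δ + 4 * (K₁ * (2 * δ)) ^ 2 + 3 * K₁ * unifB P R δ + 2 * δ ^ 2 +
        (6 * (2 * (K₁ * (2 * δ))) ^ 2 + 4 * (2 * (K₁ * (2 * δ))) ^ 3 + (2 * (K₁ * (2 * δ))) ^ 4) +
        (4 * (2 * (K₁ * (2 * δ))) + 2 * (6 * (2 * (K₁ * (2 * δ))) ^ 2 + 4 * (2 * (K₁ * (2 * δ))) ^ 3 + (2 * (K₁ * (2 * δ))) ^ 4)) * δ ≤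
      lam * δ + Cq P R lam β K₁ * δ₀ * δ := by
  rw [bianchiB_eq, unifB_eq]
  have hbq : 0 ≤ bq P (R + 1) := by unfold bq; positivity
  have huq : 0 ≤ uq P R := by unfold uq; positivity
  set t : ℝ := 2 * (K₁ * (2 * δ)) with ht
  have ht0 : 0 ≤ t := by rw [ht]; positivity
  have ht1 : t ≤ 1 := by rw [ht]; nlinarith
  have hδ1 : δ ≤ 1 := hδδ₀.trans hδ₀
  -- `ρ(t) ≤ 11 t²` and `t² = 16 K₁² δ²`
  have hρ : 6 * t ^ 2 + 4 * t ^ 3 + t ^ 4 ≤ 11 * t ^ 2 := by nlinarith [sq_nonneg t, mul_nonneg ht0 (sq_nonneg t)]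
  have ht2 : t ^ 2 = 16 * K₁ ^ 2 * δ ^ 2 := by rw [ht]; ring
  have hδ2 : δ ^ 2 ≤ δ₀ * δ := by rw [sq]; exact mul_le_mul_of_nonneg_right hδδ₀ hδ.le
  -- every second-order term against `δ₀·δ`
  have e1 : lam * (δ + 2 * δ ^ 2) ≤ lam * δ + 2 * lam * (δ₀ * δ) := by nlinarith
  have e2 : β * (bq P (R + 1) * δ ^ 2) ≤ β * bq P (R + 1) * (δ₀ * δ) := by nlinarith [mul_nonneg hβ hbq]
  have e3 : 4 * (K₁ * (2 * δ)) ^ 2 ≤ 16 * K₁ ^ 2 * (δ₀ * δ) := by nlinarith [sq_nonneg K₁]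
  have e4 : 3 * K₁ * (uq P R * δ ^ 2) ≤ 3 * K₁ * uq P R * (δ₀ * δ) := by nlinarith [mul_nonneg hK huq]
  have e5 : 2 * δ ^ 2 ≤ 2 * (δ₀ * δ) := by linarith
  have e6 : 6 * t ^ 2 + 4 * t ^ 3 + t ^ 4 ≤ 176 * K₁ ^ 2 * (δ₀ * δ) := by nlinarith [sq_nonneg K₁]
  have e7 : (4 * t + 2 * (6 * t ^ 2 + 4 * t ^ 3 + t ^ 4)) * δ ≤ (16 * K₁ + 352 * K₁ ^ 2) * (δ₀ * δ) := by
    have h1 : (4 * t + 2 * (6 * t ^ 2 + 4 * t ^ 3 + t ^ 4)) * δ ≤ (4 * t + 22 * t ^ 2) * δ := by nlinarith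
    have h2 : (4 * t + 22 * t ^ 2) * δ = 16 * K₁ * δ ^ 2 + 352 * K₁ ^ 2 * δ ^ 2 * δ := by rw [ht]; ring
    have h3 : 352 * K₁ ^ 2 * δ ^ 2 * δ ≤ 352 * K₁ ^ 2 * (δ₀ * δ) := by
      have : δ ^ 2 * δ ≤ δ₀ * δ := by nlinarith
      nlinarith [sq_nonneg K₁]
    nlinarith [sq_nonneg K₁]
  unfold Cq
  nlinarith [e1, e2, e3, e4, e5, e6, e7]

/-! ## §2 The approximate lift step and the family schema from a kernel -/

/-- **`ApproxLiftStep` FROM A KERNEL**: a face-supported, S-neutral table of row mass `≤ K₁` with the row bound `(λ, β)` gives, for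
`0 < δ ≤ δ₀`, `δ₀ ≤ 1/3`, `16K₁δ₀ ≤ 1/20`, approximate one-step lifts on `SU(2)` with gain `λ + (Cq+1)δ₀` and accuracy `452K₁²δ²`
(standing range). -/
theorem approxLiftStep_of_kernel (hj : j + 1 ≤ P.m + P.K) {R : ℕ}
    {kz : Fin P.d → (Fin P.d → Fin P.L) → Orient P.d → (Fin P.d → Fin (2 * R + 1)) → ℝ} {K₁ lam β : ℝ}
    (hF : FaceSupported R kz) (hS : SNeutral R kz) (hK : RowMass R kz K₁) (hRB : RowBound (Fin 2) R kz lam β) (hK0 : 0 ≤ K₁)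
    (hlam : 0 ≤ lam) (hβ : 0 ≤ β) {δ₀ δ : ℝ} (hδ : 0 < δ) (hδδ₀ : δ ≤ δ₀) (hδ₀ : δ₀ ≤ 1 / 3) (hKδ₀ : 16 * (K₁ * δ₀) ≤ 1 / 20) :
    ApproxLiftStep P j (lam + (Cq P R lam β K₁ + 1) * δ₀) (452 * K₁ ^ 2 * δ ^ 2) δ := by
  intro V hV
  have hδ3 : δ ≤ 1 / 3 := hδδ₀.trans hδ₀
  have hKδ : 16 * (K₁ * δ) ≤ 1 / 20 := by nlinarith
  have hs1 : K₁ * (2 * δ) ≤ 1 := by nlinarith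
  have hπ : Fintype.card (Fin 2) * δ < Real.pi := by
    rw [Fintype.card_fin]; have := Real.pi_gt_three; push_cast; nlinarith
  refine ⟨kernelLift R kz V, fun p => ?_, fun c => mdist_avgFun_kernelLift_le hj hF hS hK hδ.le hV hδ3 hKδ c⟩
  have h := dist1_plaqHol_kernelLift_le (n := Fin 2) hj hK hRB hδ hV hδ3 hπ hs1 p
  have hb := plaqBound_le_budget P R hlam hβ hK0 hδ hδδ₀ (hδ₀.trans (by norm_num)) hKδ₀
  have hpos : 0 < δ₀ * δ := mul_pos (lt_of_lt_of_le hδ hδδ₀) hδ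
  calc dist1 (GaugeField.plaqHol (kernelLift R kz V) p) ≤ lam * δ + Cq P R lam β K₁ * δ₀ * δ := h.trans hb
    _ < lam * δ + Cq P R lam β K₁ * δ₀ * δ + δ₀ * δ := lt_add_of_pos_right _ hpos
    _ = (lam + (Cq P R lam β K₁ + 1) * δ₀) * δ := by ring

/-- **`ApproxSmallLift` FROM A KERNEL FOR A FAMILY**: a table over the family's block size satisfying the four hypotheses at every run
gives `ApproxSmallLift F (λ + (Cq+1)δ₀) (452K₁²) δ₀` (`0 < δ₀ ≤ 1/3`, `16K₁δ₀ ≤ 1/20`). -/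
theorem approxSmallLift_of_kernel (F : T3Family) {R : ℕ}
    (kz : Fin 3 → (Fin 3 → Fin F.L) → Orient 3 → (Fin 3 → Fin (2 * R + 1)) → ℝ) {K₁ lam β : ℝ}
    (h : ∀ K, FaceSupported (P := F.P K) R kz ∧ SNeutral (P := F.P K) R kz ∧ RowMass (P := F.P K) R kz K₁ ∧
      RowBound (P := F.P K) (Fin 2) R kz lam β)
    (hK0 : 0 ≤ K₁) (hlam : 0 ≤ lam) (hβ : 0 ≤ β) {δ₀ : ℝ} (hδ₀ : δ₀ ≤ 1 / 3) (hKδ₀ : 16 * (K₁ * δ₀) ≤ 1 / 20) :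
    ApproxSmallLift F (lam + (Cq (F.P 0) R lam β K₁ + 1) * δ₀) (452 * K₁ ^ 2) δ₀ := by
  intro K j hj δ hδ hδδ₀
  obtain ⟨hF, hS, hK, hRB⟩ := h K
  have hCq : Cq (F.P K) R lam β K₁ = Cq (F.P 0) R lam β K₁ := rfl
  have := approxLiftStep_of_kernel hj hF hS hK hRB hK0 hlam hβ hδ hδδ₀ hδ₀ hKδ₀
  rw [hCq] at this
  exact this

/-! ## §3 The per-`L` clause of the registered stub -/

/-- **THE PER-`L` CLAUSE FROM A KERNEL WITH `λ√L < 1`**: if some table over `Fin 3 → Fin L` (given for every family of block size `L`)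
satisfies the four hypotheses at every run with constants `K₁, λ, β ≥ 0` and `λ√L < 1`, then
`∃ κ₀ C δ₀, 0 ≤ κ₀ ∧ κ₀√L < 1 ∧ 0 ≤ C ∧ 0 < δ₀ ∧ ∀ F, F.L = L → ApproxSmallLift F κ₀ C δ₀` — the `L`-th instance of the hypothesis of
`oneStepSmallLift_stub_of_approx`. -/
theorem exists_approxSmallLift_of_kernel (L : ℕ) (R : ℕ) (tab : (F : T3Family) → Fin 3 → (Fin 3 → Fin F.L) → Orient 3 → (Fin 3 → Fin (2 * R + 1)) → ℝ)
    {K₁ lam β Cq₀ : ℝ} (hK0 : 0 ≤ K₁) (hlam : 0 ≤ lam) (hβ : 0 ≤ β) (hgain : lam * Real.sqrt L < 1) (hCq₀ : 0 ≤ Cq₀)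
    (h : ∀ F : T3Family, F.L = L → (Cq (F.P 0) R lam β K₁ ≤ Cq₀) ∧ ∀ K, FaceSupported (P := F.P K) R (tab F) ∧
      SNeutral (P := F.P K) R (tab F) ∧ RowMass (P := F.P K) R (tab F) K₁ ∧ RowBound (P := F.P K) (Fin 2) R (tab F) lam β) :
    ∃ κ₀ C δ₀ : ℝ, 0 ≤ κ₀ ∧ κ₀ * Real.sqrt L < 1 ∧ 0 ≤ C ∧ 0 < δ₀ ∧ ∀ F : T3Family, F.L = L → ApproxSmallLift F κ₀ C δ₀ := by
  set sL : ℝ := Real.sqrt L with hsL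
  have hsL0 : 0 ≤ sL := Real.sqrt_nonneg _
  have hgap : 0 < 1 - lam * sL := by linarith
  -- the radius
  set δ₀ : ℝ := min (min (1 / 3) (1 / (320 * K₁ + 1))) ((1 - lam * sL) / (2 * ((Cq₀ + 1) * sL + 1))) with hδ₀
  have hA : 0 < 320 * K₁ + 1 := by positivity
  have hB : 0 < 2 * ((Cq₀ + 1) * sL + 1) := by positivity
  have hδ₀pos : 0 < δ₀ := lt_min (lt_min (by norm_num) (by positivity)) (div_pos hgap hB)
  have hδ₀3 : δ₀ ≤ 1 / 3 := (min_le_left _ _).trans (min_le_left _ _)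
  have hδ₀K : δ₀ ≤ 1 / (320 * K₁ + 1) := (min_le_left _ _).trans (min_le_right _ _)
  have hδ₀g : δ₀ ≤ (1 - lam * sL) / (2 * ((Cq₀ + 1) * sL + 1)) := min_le_right _ _
  have hKδ₀ : 16 * (K₁ * δ₀) ≤ 1 / 20 := by
    have := (le_div_iff₀ hA).mp hδ₀K
    nlinarith
  refine ⟨lam + (Cq₀ + 1) * δ₀, 452 * K₁ ^ 2, δ₀, by positivity, ?_, by positivity, hδ₀pos, fun F hFL => ?_⟩
  · have := (le_div_iff₀ hB).mp hδ₀g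
    nlinarith
  · obtain ⟨hC, hK⟩ := h F hFL
    have happ := approxSmallLift_of_kernel F (tab F) hK hK0 hlam hβ hδ₀3 hKδ₀
    -- monotonicity of the schema in the gain
    intro K j hj δ hδ hδδ₀ V hV
    obtain ⟨U, hU, hacc⟩ := happ K j hj δ hδ hδδ₀ V hV
    refine ⟨U, fun p => (hU p).trans_le ?_, hacc⟩
    have : (lam + (Cq (F.P 0) R lam β K₁ + 1) * δ₀) ≤ lam + (Cq₀ + 1) * δ₀ := by nlinarith
    exact mul_le_mul_of_nonneg_right this hδ.le

end Summit.QuantumFields.YangMills.Theorems.ApproxLift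

end
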